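import Mathlib
import Summits.ValiantsHypothesis.ValiantsHypothesis.Theorems.KPlusLogSqLawStepSharpFamily
import Summits.ValiantsHypothesis.ValiantsHypothesis.Theorems.KPlusLogSqLawStepSharpWindows

/-!
# The plateau length law is sharp at every odd reach: `d + 2` consecutive steps for all odd `d ≥ 3`

Cell pub-symmetroid, seat conjb-2 (g22). A helper toward the crux `TropicalB`
(`Summit.ValiantsHypothesis.ValiantsHypothesis.Theses.KPlusLogSqLaw.TropicalB`, item
`stmt-ValiantsHypothesis-19771`); it earns no crux credit and is not evidence for `MatrixDescartes` or for
Valiant's hypothesis. Imports only Mathlib and the two family-M' files `KPlusLogSqLawStepSharpFamily` (data, vertex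
lemmas) and `KPlusLogSqLawStepSharpWindows` (separation of the windows).

Main result `steps_attain_length_bound`: for every odd `d ≥ 3` there are real slopes `s`, intercepts `b` and points `θ`
such that, in the static path model (`S_t(x) = b t + s t * x`, even = upper), every window `[j, j+d]`, `0 ≤ j ≤ d+2`,
is separated at `θ j`, and NO point separates two consecutive windows `j`, `j+1` (`0 ≤ j ≤ d+1`) — so all `d + 2` rows
step. Together with the pencil length law `k ≤ d + 2` (THEORY-NOTE-g22 §1) this pins the maximal plateau length at odd
reach `d` to exactly `d + 2`; the instances `d = 3, 5, 7` are `KPlusLogSqLawStepSharp`. The configuration is family M'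
(`sM`, `bM`) with `θ 0 = -ε`, `θ j = j - 1/2` (`1 ≤ j ≤ d`), `θ (d+1) = d + ε`, `θ (d+2) = d - ε`,
`ε = 1/((n+1)(2n+3)+4n+5)`, `d = 2n+1`. Here: NON-SEPARATION of consecutive windows — rows `j ≤ d` contain the binding
pairs `{j, j+1}` (window `j`) and `{j+1, j+d+1}` (window `j+1`) of lines through `X_j` with opposite slope order, forcing
`x < x_j` and `x > x_j`; row `d+1` likewise at `X_d` with the pairs `{d+1, 2d+1}` and `{2d+2, 2d+1}` — and the assembly.
-/

set_option linter.dupNamespace false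

namespace Summit.ValiantsHypothesis.ValiantsHypothesis.Theorems.KPlusLogSqLawStepSharpAll

open Summit.ValiantsHypothesis.ValiantsHypothesis.Theorems.KPlusLogSqLawStepSharpFamily
open Summit.ValiantsHypothesis.ValiantsHypothesis.Theorems.KPlusLogSqLawStepSharpWindows

/-! ## Consecutive windows are never separated at a common point -/

/-- Opposite-sign squeeze: `c₁ (x - v) < 0 < c₂ (x - v)` with `c₁, c₂ > 0` is impossible. -/
theorem squeeze (x v c₁ c₂ : ℝ) (hc₁ : 0 < c₁) (hc₂ : 0 < c₂) (h1 : c₁ * (x - v) < 0)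
    (h2 : 0 < c₂ * (x - v)) : False := by
  rcases lt_or_ge (x - v) 0 with h | h
  · have : c₂ * (x - v) < 0 := mul_neg_of_pos_of_neg hc₂ h
    linarith
  · have : 0 ≤ c₁ * (x - v) := mul_nonneg hc₁.le h
    linarith

/-- Rows `j ≤ d`: windows `j` and `j+1` have disjoint separation sets (lines `j, j+1, j+d+1` through `X_j`). -/
theorem rows_low (n j : ℕ) (hn : 1 ≤ n) (hj : j ≤ 2 * n + 1) (x : ℝ)
    (h1 : ∀ e o : ℕ, j ≤ e → e ≤ j + (2 * n + 1) → j ≤ o → o ≤ j + (2 * n + 1) → Even e → ¬ Even o →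
      (bM n o : ℝ) + (sM n o : ℝ) * x < (bM n e : ℝ) + (sM n e : ℝ) * x)
    (h2 : ∀ e o : ℕ, j + 1 ≤ e → e ≤ j + 1 + (2 * n + 1) → j + 1 ≤ o → o ≤ j + 1 + (2 * n + 1) → Even e →
      ¬ Even o → (bM n o : ℝ) + (sM n o : ℝ) * x < (bM n e : ℝ) + (sM n e : ℝ) * x) : False := by
  have z0 : EM n j j = 0 := EM_self n j hj
  have z1 : EM n (j + 1) j = 0 := EM_succ n j hj
  have z2 : EM n (j + (2 * n + 2)) j = 0 := EM_far n j hj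
  have v0 := val_at n j j x
  have v1 := val_at n (j + 1) j x
  have v2 := val_at n (j + (2 * n + 2)) j x
  rw [z0] at v0; rw [z1] at v1; rw [z2] at v2
  rcases Nat.even_or_odd j with ⟨a, ha⟩ | ⟨a, ha⟩
  · -- j = 2a even: pairs (j, j+1) in window j and (j+d+1, j+1) in window j+1
    have hje : Even j := ⟨a, ha⟩
    have hjo : ¬ Even (j + 1) := by rw [Nat.even_add_one]; exact fun h => h hje
    have hfe : Even (j + (2 * n + 2)) := by rw [Nat.even_add]; exact iff_of_true hje ⟨n + 1, by ring⟩
    have I1 := h1 j (j + 1) le_rfl (by omega) (by omega) (by omega) hje hjo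
    have I2 := h2 (j + (2 * n + 2)) (j + 1) (by omega) (by omega) le_rfl (by omega) hfe hjo
    rw [v0, v1] at I1; rw [v1, v2] at I2
    -- slope order at X_j: s j < s (j+1) < s (j+d+1)
    have ha' : j = 2 * a := by omega
    have c1 : sM n j < sM n (j + 1) := by
      rw [ha', sM_u n a (by omega)]
      by_cases hl : a + 1 ≤ n
      · rw [sM_l n a hl]; linarith
      · have : a = n := by omega
        subst this
        rw [sM_last]
        have : (0 : ℤ) ≤ a := by positivity
        nlinarith
    have c2 : sM n (j + 1) < sM n (j + (2 * n + 2)) := by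
      rw [ha']
      rcases Nat.eq_zero_or_pos a with rfl | hpos
      · have e1 : 2 * 0 + (2 * n + 2) = 2 * n + 2 := by ring
        rw [e1, sM_chord]
        have := sM_l n 0 (by omega)
        simp only [Nat.mul_zero, Nat.zero_add, Nat.cast_zero, add_zero] at this
        rw [show 2 * 0 + 1 = 1 by rfl, this]; linarith
      · have e1 : 2 * a + (2 * n + 2) = 2 * n + 2 + 2 * a := by ring
        rw [e1, sM_uw n a hpos (by omega)]
        by_cases hl : a + 1 ≤ n
        · rw [sM_l n a hl]
          have : (0 : ℤ) ≤ n := by positivity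
          nlinarith
        · have : a = n := by omega
          subst this
          rw [sM_last]
          have : (1 : ℤ) ≤ a := by exact_mod_cast hpos
          linarith
    have c1' : (0 : ℝ) < (sM n (j + 1) : ℝ) - sM n j := by
      have : ((sM n j : ℤ) : ℝ) < (sM n (j + 1) : ℤ) := by exact_mod_cast c1
      linarith
    have c2' : (0 : ℝ) < (sM n (j + (2 * n + 2)) : ℝ) - sM n (j + 1) := by
      have : ((sM n (j + 1) : ℤ) : ℝ) < (sM n (j + (2 * n + 2)) : ℤ) := by exact_mod_cast c2
      linarith
    refine squeeze x (j : ℝ) _ _ c1' c2' ?_ ?_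
    · push_cast at I1 ⊢; nlinarith [I1]
    · push_cast at I2 ⊢; nlinarith [I2]
  · -- j = 2a+1 odd: pairs (j+1, j) in window j and (j+1, j+d+1) in window j+1
    have hjo : ¬ Even j := by rw [Nat.even_iff]; omega
    have hje : Even (j + 1) := ⟨a + 1, by omega⟩
    have hfo : ¬ Even (j + (2 * n + 2)) := by rw [Nat.even_iff]; omega
    have I1 := h1 (j + 1) j (by omega) (by omega) le_rfl (by omega) hje hjo
    have I2 := h2 (j + 1) (j + (2 * n + 2)) le_rfl (by omega) (by omega) (by omega) hje hfo
    rw [v0, v1] at I1; rw [v1, v2] at I2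
    -- slope order at X_j: s (j+d+1) < s (j+1) < s j
    subst ha
    have c1 : sM n (2 * a + 1 + 1) < sM n (2 * a + 1) := by
      have e1 : 2 * a + 1 + 1 = 2 * (a + 1) := by ring
      rw [e1]
      by_cases hl : a + 1 ≤ n
      · rw [sM_u n (a + 1) hl, sM_l n a hl]; push_cast; linarith
      · have : a = n := by omega
        subst this
        have e2 : 2 * (a + 1) = 2 * a + 2 := by ring
        rw [e2, sM_chord, sM_last]
        have : (1 : ℤ) ≤ a := by exact_mod_cast hn
        nlinarith
    have c2 : sM n (2 * a + 1 + (2 * n + 2)) < sM n (2 * a + 1 + 1) := by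
      have e1 : 2 * a + 1 + 1 = 2 * (a + 1) := by ring
      rw [e1]
      by_cases hl : a + 1 ≤ n
      · have e2 : 2 * a + 1 + (2 * n + 2) = 2 * n + 1 + 2 * (a + 1) := by ring
        rw [e2, sM_lw n (a + 1) (by omega) hl, sM_u n (a + 1) hl]
        push_cast
        have : ((a : ℕ) : ℤ) + 1 ≤ n := by exact_mod_cast hl
        linarith
      · have : a = n := by omega
        subst this
        have e2 : 2 * a + 1 + (2 * a + 2) = 4 * a + 3 := by ring
        have e3 : 2 * (a + 1) = 2 * a + 2 := by ring
        rw [e2, e3, sM_l2d1, sM_chord]; linarith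
    have c1' : (0 : ℝ) < (sM n (2 * a + 1) : ℝ) - sM n (2 * a + 1 + 1) := by
      have : ((sM n (2 * a + 1 + 1) : ℤ) : ℝ) < (sM n (2 * a + 1) : ℤ) := by exact_mod_cast c1
      linarith
    have c2' : (0 : ℝ) < (sM n (2 * a + 1 + 1) : ℝ) - sM n (2 * a + 1 + (2 * n + 2)) := by
      have : ((sM n (2 * a + 1 + (2 * n + 2)) : ℤ) : ℝ) < (sM n (2 * a + 1 + 1) : ℤ) := by
        exact_mod_cast c2
      linarith
    refine squeeze x ((2 * a + 1 : ℕ) : ℝ) _ _ c1' c2' ?_ ?_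
    · push_cast at I1 ⊢; nlinarith [I1]
    · push_cast at I2 ⊢; nlinarith [I2]

/-- Row `d+1`: windows `d+1` and `d+2` have disjoint separation sets (lines `d+1, 2d+1, 2d+2` through `X_d`). -/
theorem row_top (n : ℕ) (x : ℝ)
    (h1 : ∀ e o : ℕ, 2 * n + 2 ≤ e → e ≤ 2 * n + 2 + (2 * n + 1) → 2 * n + 2 ≤ o →
      o ≤ 2 * n + 2 + (2 * n + 1) → Even e → ¬ Even o →
      (bM n o : ℝ) + (sM n o : ℝ) * x < (bM n e : ℝ) + (sM n e : ℝ) * x)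
    (h2 : ∀ e o : ℕ, 2 * n + 2 + 1 ≤ e → e ≤ 2 * n + 2 + 1 + (2 * n + 1) → 2 * n + 2 + 1 ≤ o →
      o ≤ 2 * n + 2 + 1 + (2 * n + 1) → Even e → ¬ Even o →
      (bM n o : ℝ) + (sM n o : ℝ) * x < (bM n e : ℝ) + (sM n e : ℝ) * x) : False := by
  have z1 : EM n (2 * n + 2) (2 * n + 1) = 0 := EM_succ n (2 * n + 1) le_rfl
  have z2 : EM n (4 * n + 3) (2 * n + 1) = 0 := by
    have := EM_far n (2 * n + 1) le_rfl
    have e : 2 * n + 1 + (2 * n + 2) = 4 * n + 3 := by ring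
    rwa [e] at this
  have z3 : EM n (4 * n + 4) (2 * n + 1) = 0 := EM_top n
  have v1 := val_at n (2 * n + 2) (2 * n + 1) x
  have v2 := val_at n (4 * n + 3) (2 * n + 1) x
  have v3 := val_at n (4 * n + 4) (2 * n + 1) x
  rw [z1] at v1; rw [z2] at v2; rw [z3] at v3
  have hce : Even (2 * n + 2) := ⟨n + 1, by ring⟩
  have hto : ¬ Even (4 * n + 3) := by rw [Nat.even_iff]; omega
  have hte : Even (4 * n + 4) := ⟨2 * n + 2, by ring⟩
  have I1 := h1 (2 * n + 2) (4 * n + 3) le_rfl (by omega) (by omega) (by omega) hce hto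
  have I2 := h2 (4 * n + 4) (4 * n + 3) (by omega) (by omega) (by omega) (by omega) hte hto
  rw [v1, v2] at I1; rw [v2, v3] at I2
  rw [sM_chord, sM_l2d1] at I1; rw [sM_l2d1, sM_u2d2] at I2
  push_cast at I1 I2
  nlinarith [I1, I2]

/-! ## Main theorems -/

/-- Sharpness at reach `2n+1`, `n ≥ 1`, in the raw window format. -/
theorem sharp (n : ℕ) (hn : 1 ≤ n) :
    ∃ s b θ : ℕ → ℝ,
      (∀ j : ℕ, j ≤ 2 * n + 1 + 2 → ∀ e o : ℕ, j ≤ e → e ≤ j + (2 * n + 1) → j ≤ o → o ≤ j + (2 * n + 1) →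
        Even e → ¬ Even o → b o + s o * θ j < b e + s e * θ j) ∧
      (∀ j : ℕ, j < 2 * n + 1 + 2 → ∀ x : ℝ,
        (∀ e o : ℕ, j ≤ e → e ≤ j + (2 * n + 1) → j ≤ o → o ≤ j + (2 * n + 1) → Even e → ¬ Even o →
          b o + s o * x < b e + s e * x) →
        (∀ e o : ℕ, j + 1 ≤ e → e ≤ j + 1 + (2 * n + 1) → j + 1 ≤ o → o ≤ j + 1 + (2 * n + 1) →
          Even e → ¬ Even o → b o + s o * x < b e + s e * x) → False) := by
  set B : ℝ := (n + 1) * (2 * n + 3) + 4 * n + 5 with hB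
  have hBpos : 0 < B := by rw [hB]; positivity
  set ε : ℝ := 1 / B with hεdef
  have hε : 0 < ε := by rw [hεdef]; positivity
  have hεB : ε * ((n + 1) * (2 * n + 3) + 4 * n + 5 : ℝ) ≤ 1 := by
    rw [hεdef, ← hB, div_mul_cancel₀ 1 (ne_of_gt hBpos)]
  refine ⟨fun t => (sM n t : ℝ), fun t => (bM n t : ℝ),
    fun j => if j = 0 then -ε else if j ≤ 2 * n + 1 then (j : ℝ) - 1 / 2
      else if j = 2 * n + 2 then ((2 * n + 1 : ℕ) : ℝ) + ε else ((2 * n + 1 : ℕ) : ℝ) - ε, ?_, ?_⟩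
  · intro j hj e o he1 he2 ho1 ho2 he ho
    dsimp only
    by_cases hj0 : j = 0
    · rw [if_pos hj0]
      exact window_zero n hn ε hε hεB e o (by omega) (by omega) he ho
    by_cases hjm : j ≤ 2 * n + 1
    · rw [if_neg hj0, if_pos hjm]
      exact window_mid n j hn (by omega) hjm e o he1 he2 ho1 ho2 he ho
    by_cases hj1 : j = 2 * n + 2
    · rw [if_neg hj0, if_neg hjm, if_pos hj1]
      subst hj1
      exact window_dsucc n ε hε hεB e o he1 he2 ho1 ho2 he ho
    · have hj2 : j = 2 * n + 3 := by omega
      rw [if_neg hj0, if_neg hjm, if_neg hj1]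
      subst hj2
      exact window_dsucc2 n ε hε hεB e o he1 he2 ho1 ho2 he ho
  · intro j hj x h1 h2
    by_cases hjl : j ≤ 2 * n + 1
    · exact rows_low n j hn hjl x h1 h2
    · have hj1 : j = 2 * n + 2 := by omega
      subst hj1
      exact row_top n x h1 h2

/-- THE LENGTH LAW IS SHARP AT EVERY ODD REACH: for every odd `d ≥ 3` some configuration has all windows
`0, …, d+2` separated and all `d + 2` rows `0, …, d+1` stepping (consecutive windows never separated together). -/
theorem steps_attain_length_bound (d : ℕ) (hd : Odd d) (h3 : 3 ≤ d) :
    ∃ s b θ : ℕ → ℝ,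
      (∀ j : ℕ, j ≤ d + 2 → ∀ e o : ℕ, j ≤ e → e ≤ j + d → j ≤ o → o ≤ j + d →
        Even e → ¬ Even o → b o + s o * θ j < b e + s e * θ j) ∧
      (∀ j : ℕ, j < d + 2 → ∀ x : ℝ,
        (∀ e o : ℕ, j ≤ e → e ≤ j + d → j ≤ o → o ≤ j + d → Even e → ¬ Even o →
          b o + s o * x < b e + s e * x) →
        (∀ e o : ℕ, j + 1 ≤ e → e ≤ j + 1 + d → j + 1 ≤ o → o ≤ j + 1 + d →
          Even e → ¬ Even o → b o + s o * x < b e + s e * x) → False) := by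
  obtain ⟨n, rfl⟩ := hd
  exact sharp n (by omega)

end Summit.ValiantsHypothesis.ValiantsHypothesis.Theorems.KPlusLogSqLawStepSharpAll
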